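import Literature.Probability.LatticeModels.SHolomorphicityProof
import Literature.Probability.LatticeModels.MedialPerturbation
import Literature.Probability.Percolation.InterfaceTraversalBound
import HarnessLib

/-!
# Cycles of the turning rule separate: the planar fact T1, proved

Topic `Literature/Probability/LatticeModels`; tenth instalment of the discharge programme for
crit-ising.S18, node 1. The named fact `medialCycle_separates` (T1 of `WeightTable.lean`:
if the two corners arriving at a closed lattice edge lie on different cycles of the turning
rule, the endpoints of the edge are not joined by open edges) is **proved** here
(`medialCycle_separates_holds`), by the winding-number bookkeeping of
`Topology/PlaneTopology/ArgumentIncrement.lean` applied to the *closed perturbed polygon* of a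
cycle, built from the pieces of `MedialPerturbation.lean` exactly as the open exploration
polygon of `Percolation/ExplorationPolygon.lean`:

* `cyV`, `cyF`, `cyS`, `cyT`, `cyDart`, `cyConn`, `cyPath`, `cyLoop`: the corners
  `orb m = (v_m, k_m)` of the orbit of `q` under `nextCorner β`, their faces `cFace`, shifted
  source/target points (mesh `1`), dart pieces, connectors, the polygon over darts `0 … k` and
  the closed polygon of a cycle of period `n + 1` (`Path.cast` of the polygon plus the closing
  connector); `range_cyLoop_subset`, `crossInc_cyLoop_eq` (the crossing defect of the closed
  polygon relative to `[ℓ, r]` is that of its first dart piece when all other pieces miss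
  `[ℓ, r]`).
* `cy_turn_cases`, `cyConn_cases`: after each dart the cycle makes a vertex turn (crossed edge
  closed; `VConnShape`) or a face turn (followed edge open; `FConnShape`) — from
  `nextCorner_of_(not_)mem`, `cFace_nextCorner_of_(not_)mem`, `vertexTurn_dirs`,
  `faceTurn_dirs`.
* What the pieces can meet: lattice points and face centres miss all pieces; connectors miss
  half-diagonals; a dart piece meets the half-diagonal of `(v, faceAt v k)` only if its corner
  is `(v, k)` (`cy_eq_of_mem_halfDiag`); open edges miss all pieces (a connector meets a lattice
  edge only at a vertex turn, whose crossed edge is closed — `cyConn_disjoint_edgeTrace`).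
* `wind_cyLoop_eq_of_segment` / `_of_reachable`: points joined by a segment off the polygon, in
  particular the endpoints of an open edge and hence of a walk of open edges, have equal
  winding numbers (`wind_sub_eq_of_mem_connectedComponentIn`).
* **`medialCycle_separates_holds`**: for the cycle through the partner `q = (y, k+2)` of
  `p = (x, k)` (minimal period, `Nat.find`), the closed polygon crosses the half-diagonal from
  `y` into the common face `f = faceAt y (k+2) = faceAt x (k+1)` exactly once, transversally
  (`crossInc_dartSeg_ne_zero`, so `wind y ≠ wind (centre f)` by `Path.crossInc_loop`), and
  misses the half-diagonal from `x` (its only possible dart would be the corner `(x, k+1)`,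
  the successor of `p`, forcing `p` onto the cycle by injectivity of `nextCorner`), so
  `wind x = wind (centre f)`; an open path from `x` to `y` would give `wind x = wind y`.

Consequence: node 1 now depends on T2 (`medialCycle_turning`, Hopf's Umlaufsatz) alone,
`isSHolomorphic_fkIsingObservable_of_zdArcA_connected_of_turning`.
-/

noncomputable section

open Set Complex Literature.Topology.PlaneTopology

namespace Literature.Probability.LatticeModels

section Cycle

variable (β : Percolation.BondConfig (Site 2)) (q : Site 2 × Fin 4)

/-- The vertex of the `m`-th corner of the orbit of `q`. [folklore] -/
def cyV (m : ℕ) : Site 2 := (cornerOrbit β q m).1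

/-- The face of the `m`-th corner of the orbit of `q`. [folklore] -/
def cyF (m : ℕ) : Site 2 := cFace (cornerOrbit β q m)

/-- The shifted source point of the `m`-th dart (mesh `1`). [folklore] -/
def cyS (m : ℕ) : ℂ := dartPt (cyV β q m) (cyF β q m) (srcDir (cyV β q m) (cyF β q m))

/-- The shifted target point of the `m`-th dart (mesh `1`). [folklore] -/
def cyT (m : ℕ) : ℂ := dartPt (cyV β q m) (cyF β q m) (tgtDir (cyV β q m) (cyF β q m))

/-- The `m`-th dart piece. [folklore] -/
def cyDart (m : ℕ) : Set ℂ := segment ℝ (cyS β q m) (cyT β q m)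

/-- The connector after the `m`-th dart (to the `m+1`-st). [folklore] -/
def cyConn (m : ℕ) : Set ℂ := segment ℝ (cyT β q m) (cyS β q (m + 1))

/-- **The perturbed polygon over the darts `0, …, k`** of the orbit of `q`, as a path.
[folklore] -/
def cyPath : ∀ k : ℕ, Path (cyS β q 0) (cyT β q k)
  | 0 => Path.segment (cyS β q 0) (cyT β q 0)
  | k + 1 => (cyPath k).trans
      ((Path.segment (cyT β q k) (cyS β q (k + 1))).trans (Path.segment (cyS β q (k + 1)) (cyT β q (k + 1))))

variable {β q}

/-- Each orbit corner is a corner of its face. [folklore] -/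
theorem isCorner_cy (m : ℕ) : IsCorner (cyV β q m) (cyF β q m) := isCorner_faceAt _ _

/-- The dart piece is the dart segment of `MedialPerturbation`. [folklore] -/
theorem cyDart_eq (m : ℕ) : cyDart β q m = dartSeg (cyV β q m) (cyF β q m) := by
  rw [cyDart, dartSeg_eq_segment_src_tgt]; rfl

/-- Periodicity of the shifted source points. [folklore] -/
theorem cyS_of_eq {m n : ℕ} (h : cornerOrbit β q m = cornerOrbit β q n) : cyS β q m = cyS β q n := by
  simp only [cyS, cyV, cyF, h]

/-- **The range of the polygon** is the union of its dart pieces and connectors. [folklore] -/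
theorem range_cyPath_subset : ∀ k : ℕ, range (cyPath β q k) ⊆
    (⋃ (j : ℕ) (_ : j ≤ k), cyDart β q j) ∪ ⋃ (j : ℕ) (_ : j < k), cyConn β q j
  | 0 => by
    intro z hz
    rw [cyPath, Path.range_segment] at hz
    exact Or.inl (mem_iUnion₂.2 ⟨0, le_rfl, hz⟩)
  | k + 1 => by
    intro z hz
    rw [cyPath, Path.trans_range, Path.trans_range, Path.range_segment, Path.range_segment] at hz
    rcases hz with hz | hz | hz
    · rcases range_cyPath_subset k hz with h | h
      · obtain ⟨j, hj, h⟩ := mem_iUnion₂.1 h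
        exact Or.inl (mem_iUnion₂.2 ⟨j, by omega, h⟩)
      · obtain ⟨j, hj, h⟩ := mem_iUnion₂.1 h
        exact Or.inr (mem_iUnion₂.2 ⟨j, by omega, h⟩)
    · exact Or.inr (mem_iUnion₂.2 ⟨k, by omega, hz⟩)
    · exact Or.inl (mem_iUnion₂.2 ⟨k + 1, le_rfl, hz⟩)

/-- A point of a straight path lies on the segment. [folklore] -/
theorem segment_apply_mem (A B : ℂ) (t : unitInterval) : Path.segment A B t ∈ segment ℝ A B := by
  have : Path.segment A B t ∈ range (Path.segment A B) := ⟨t, rfl⟩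
  rwa [Path.range_segment] at this

/-- **The polygon has the crossing defect of its first dart piece** relative to `[ℓ, r]`, if all
other dart pieces and all connectors miss `[ℓ, r]` and the first dart piece misses `ℓ`, `r`.
[folklore] -/
theorem crossInc_cyPath_eq {ℓ r : ℂ} : ∀ k : ℕ,
    (∀ j, 1 ≤ j → j ≤ k → ∀ z ∈ cyDart β q j, z ∉ segment ℝ ℓ r) →
    (∀ j, j < k → ∀ z ∈ cyConn β q j, z ∉ segment ℝ ℓ r) →
    ℓ ∉ cyDart β q 0 → r ∉ cyDart β q 0 →
      (cyPath β q k).crossInc ℓ r = (Path.segment (cyS β q 0) (cyT β q 0)).crossInc ℓ r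
  | 0 => fun _ _ _ _ => rfl
  | k + 1 => by
    intro hd hc hℓ hr
    have hoff : ∀ p, p ∈ segment ℝ ℓ r → p ∉ cyDart β q 0 →
        p ∉ range (cyPath β q k) ∧ p ∉ range (Path.segment (cyT β q k) (cyS β q (k + 1))) ∧
        p ∉ range (Path.segment (cyS β q (k + 1)) (cyT β q (k + 1))) := by
      intro p hp hp'
      refine ⟨fun h => ?_, fun h => ?_, fun h => ?_⟩
      · rcases range_cyPath_subset k h with h | h
        · obtain ⟨j, hj, h⟩ := mem_iUnion₂.1 h
          rcases Nat.eq_zero_or_pos j with rfl | hj0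
          · exact hp' h
          · exact hd j hj0 (by omega) p h hp
        · obtain ⟨j, hj, h⟩ := mem_iUnion₂.1 h
          exact hc j (by omega) p h hp
      · rw [Path.range_segment] at h
        exact hc k (by omega) p h hp
      · rw [Path.range_segment] at h
        exact hd (k + 1) (by omega) le_rfl p h hp
    obtain ⟨hl1, hl2, hl3⟩ := hoff ℓ (left_mem_segment _ _ _) hℓ
    obtain ⟨hr1, hr2, hr3⟩ := hoff r (right_mem_segment _ _ _) hr
    rw [cyPath, Path.crossInc_trans _ _ hl1 (by rw [Path.trans_range]; rintro (h | h); exacts [hl2 h, hl3 h])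
      hr1 (by rw [Path.trans_range]; rintro (h | h); exacts [hr2 h, hr3 h]),
      Path.crossInc_trans _ _ hl2 hl3 hr2 hr3,
      crossInc_cyPath_eq k (fun j hj1 hj => hd j hj1 (by omega)) (fun j hj => hc j (by omega)) hℓ hr,
      Path.crossInc_eq_zero (Path.segment (cyT β q k) (cyS β q (k + 1))) (fun t =>
        hc k (by omega) _ (segment_apply_mem _ _ t)),
      Path.crossInc_eq_zero (Path.segment (cyS β q (k + 1)) (cyT β q (k + 1))) (fun t =>
        hd (k + 1) (by omega) le_rfl _ (segment_apply_mem _ _ t))]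
    ring

/-- Casting the endpoints of a path does not change its crossing defect. [folklore] -/
theorem Path.crossInc_cast {x y x' y' : ℂ} (γ : Path x y) (hx : x' = x) (hy : y' = y) (ℓ r : ℂ) :
    (γ.cast hx hy).crossInc ℓ r = γ.crossInc ℓ r := by
  subst hx hy; rfl

/-- The range of a cast path. [folklore] -/
theorem Path.range_cast {X : Type*} [TopologicalSpace X] {x y x' y' : X} (γ : _root_.Path x y) (hx : x' = x) (hy : y' = y) :
    range (γ.cast hx hy) = range γ := by
  subst hx hy; rfl

/-- **The closed perturbed polygon** of a cycle of the turning rule of period `n + 1` through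
`q`: the darts `0, …, n` and the closing connector back to the first shifted source point.
[folklore] -/
def cyLoop (n : ℕ) (h : cornerOrbit β q (n + 1) = q) : Path (cyS β q 0) (cyS β q 0) :=
  ((cyPath β q n).trans (Path.segment (cyT β q n) (cyS β q (n + 1)))).cast rfl
    (cyS_of_eq (m := 0) (n := n + 1) (by rw [h]; rfl))

/-- The range of the closed polygon: dart pieces `0 … n` and connectors `0 … n`. [folklore] -/
theorem range_cyLoop_subset (n : ℕ) (h : cornerOrbit β q (n + 1) = q) :
    range (cyLoop n h) ⊆ (⋃ (j : ℕ) (_ : j ≤ n), cyDart β q j) ∪ ⋃ (j : ℕ) (_ : j ≤ n), cyConn β q j := by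
  intro z hz
  have hz' : z ∈ range ((cyPath β q n).trans (Path.segment (cyT β q n) (cyS β q (n + 1)))) := by
    obtain ⟨t, rfl⟩ := hz
    exact ⟨t, rfl⟩
  rw [Path.trans_range, Path.range_segment] at hz'
  rcases hz' with hz' | hz'
  · rcases range_cyPath_subset n hz' with h' | h'
    · obtain ⟨j, hj, h'⟩ := mem_iUnion₂.1 h'
      exact Or.inl (mem_iUnion₂.2 ⟨j, hj, h'⟩)
    · obtain ⟨j, hj, h'⟩ := mem_iUnion₂.1 h'
      exact Or.inr (mem_iUnion₂.2 ⟨j, hj.le, h'⟩)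
  · exact Or.inr (mem_iUnion₂.2 ⟨n, le_rfl, hz'⟩)

/-- **The crossing defect of the closed polygon is that of its first dart piece**, when all
other pieces miss `[ℓ, r]`. [folklore] -/
theorem crossInc_cyLoop_eq {ℓ r : ℂ} (n : ℕ) (h : cornerOrbit β q (n + 1) = q)
    (hd : ∀ j, 1 ≤ j → j ≤ n → ∀ z ∈ cyDart β q j, z ∉ segment ℝ ℓ r)
    (hc : ∀ j, j ≤ n → ∀ z ∈ cyConn β q j, z ∉ segment ℝ ℓ r)
    (hℓ : ℓ ∉ cyDart β q 0) (hr : r ∉ cyDart β q 0) :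
    (cyLoop n h).crossInc ℓ r = (Path.segment (cyS β q 0) (cyT β q 0)).crossInc ℓ r := by
  have hoff : ∀ p, p ∈ segment ℝ ℓ r → p ∉ cyDart β q 0 →
      p ∉ range (cyPath β q n) ∧ p ∉ range (Path.segment (cyT β q n) (cyS β q (n + 1))) := by
    intro p hp hp'
    refine ⟨fun h' => ?_, fun h' => ?_⟩
    · rcases range_cyPath_subset n h' with h' | h'
      · obtain ⟨j, hj, h'⟩ := mem_iUnion₂.1 h'
        rcases Nat.eq_zero_or_pos j with rfl | hj0
        · exact hp' h'
        · exact hd j hj0 hj p h' hp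
      · obtain ⟨j, hj, h'⟩ := mem_iUnion₂.1 h'
        exact hc j hj.le p h' hp
    · rw [Path.range_segment] at h'
      exact hc n le_rfl p h' hp
  obtain ⟨hl1, hl2⟩ := hoff ℓ (left_mem_segment _ _ _) hℓ
  obtain ⟨hr1, hr2⟩ := hoff r (right_mem_segment _ _ _) hr
  rw [cyLoop, Path.crossInc_cast, Path.crossInc_trans _ _ hl1 hl2 hr1 hr2, crossInc_cyPath_eq n hd (fun j hj => hc j hj.le) hℓ hr,
    Path.crossInc_eq_zero _ (fun t => hc n le_rfl _ (segment_apply_mem _ _ t)), add_zero]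

/-! ### The two kinds of connectors of a cycle -/

/-- **The turn after the `m`-th dart.** Either a *vertex turn* (the crossed edge
`cTgt (orb m)` is closed: same vertex, faces `faceAt v k` and `faceAt v (k+1)`), or a *face turn*
(the followed edge is open: same face, the vertices span the followed side). [cite: Smirnov2001, §2] -/
theorem cy_turn_cases (m : ℕ) :
    (cTgt (cornerOrbit β q m) ∉ β ∧ cyV β q (m + 1) = cyV β q m ∧ cyF β q (m + 1) ≠ cyF β q m ∧
        cornerTarget (cyV β q m) (cyF β q m) = cornerSource (cyV β q m) (cyF β q (m + 1))) ∨
      (cTgt (cornerOrbit β q m) ∈ β ∧ cyF β q (m + 1) = cyF β q m ∧ cyV β q (m + 1) ≠ cyV β q m ∧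
        cornerTarget (cyV β q m) (cyF β q m) = cornerSource (cyV β q (m + 1)) (cyF β q m)) := by
  have hsucc : cornerOrbit β q (m + 1) = nextCorner β (cornerOrbit β q m) := rfl
  by_cases h : cTgt (cornerOrbit β q m) ∈ β
  · right
    refine ⟨h, ?_, ?_, ?_⟩
    · rw [cyF, cyF, hsucc, cFace_nextCorner_of_mem h]
    · rw [cyV, cyV, hsucc, nextCorner_of_mem h]
      intro h'
      have : cornerUnit ((cornerOrbit β q m).2 + 1) = 0 := by
        have h'' : (cornerOrbit β q m).1 + cornerUnit ((cornerOrbit β q m).2 + 1) = (cornerOrbit β q m).1 := h'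
        simpa using h''
      exact cornerUnit_ne_zero _ this
    · have h1 : cornerTarget (cyV β q m) (cyF β q m) = cTgt (cornerOrbit β q m) := cornerTarget_faceAt _ _
      have h2 : cornerSource (cyV β q (m + 1)) (cyF β q (m + 1)) = cSrc (cornerOrbit β q (m + 1)) :=
        cornerSource_faceAt _ _
      have hF : cyF β q (m + 1) = cyF β q m := by rw [cyF, cyF, hsucc, cFace_nextCorner_of_mem h]
      rw [h1, show cornerSource (cyV β q (m + 1)) (cyF β q m) = cornerSource (cyV β q (m + 1)) (cyF β q (m + 1)) by
        rw [hF], h2, hsucc, cSrc_nextCorner]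
  · left
    refine ⟨h, ?_, ?_, ?_⟩
    · rw [cyV, cyV, hsucc, nextCorner_of_not_mem h]
    · rw [cyF, cyF, hsucc, cFace_nextCorner_of_not_mem h, cFace, faceAt, faceAt]
      intro h'
      have : cornerOff ((cornerOrbit β q m).2 + 1) = cornerOff (cornerOrbit β q m).2 := sub_right_injective h'
      have hk : ∀ k : Fin 4, cornerOff (k + 1) ≠ cornerOff k := by decide
      exact hk _ this
    · have h1 : cornerTarget (cyV β q m) (cyF β q m) = cTgt (cornerOrbit β q m) := cornerTarget_faceAt _ _
      have h2 : cornerSource (cyV β q (m + 1)) (cyF β q (m + 1)) = cSrc (cornerOrbit β q (m + 1)) :=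
        cornerSource_faceAt _ _
      have hV : cyV β q (m + 1) = cyV β q m := by rw [cyV, cyV, hsucc, nextCorner_of_not_mem h]
      rw [h1, show cornerSource (cyV β q m) (cyF β q (m + 1)) = cornerSource (cyV β q (m + 1)) (cyF β q (m + 1)) by
        rw [hV], h2, hsucc, cSrc_nextCorner]

/-- **Shape of a connector.** A point of the connector after the `m`-th dart has either the
vertex-connector shape across the crossed (closed) edge, or the face-connector shape inside the
common face. [folklore] -/
theorem cyConn_cases (m : ℕ) {z : ℂ} (hz : z ∈ cyConn β q m) :
    (∃ I J : Fin 2, J ≠ I ∧ cTgt (cornerOrbit β q m) ∉ β ∧ cyV β q (m + 1) = cyV β q m ∧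
        cyF β q m I = cyF β q (m + 1) I ∧
        ((cyF β q m J + 1 = cyV β q m J ∧ cyF β q (m + 1) J = cyV β q m J) ∨
          (cyF β q m J = cyV β q m J ∧ cyF β q (m + 1) J + 1 = cyV β q m J)) ∧
        cornerSource (cyV β q m) (cyF β q (m + 1)) = cornerEdge (cyV β q m) (cyF β q (m + 1)) I ∧
        VConnShape I J (cyF β q m I) (cyV β q m J) z) ∨
      (∃ I J : Fin 2, J ≠ I ∧ cTgt (cornerOrbit β q m) ∈ β ∧ FConnShape I J (cyF β q m I) (cyF β q m J) z) := by
  rcases cy_turn_cases (β := β) (q := q) m with ⟨hc, hv, hf, he⟩ | ⟨ho, hf, hv, he⟩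
  · left
    have hc1 : IsCorner (cyV β q m) (cyF β q m) := isCorner_cy m
    have hc2 : IsCorner (cyV β q m) (cyF β q (m + 1)) := hv ▸ isCorner_cy (m + 1)
    obtain ⟨hdir, hcol, hside⟩ := vertexTurn_dirs hc1 hc2 hf.symm he
    obtain ⟨J, hJI⟩ := exists_ne (tgtDir (cyV β q m) (cyF β q m))
    have hz' : z ∈ segment ℝ (dartPt (cyV β q m) (cyF β q m) (tgtDir (cyV β q m) (cyF β q m)))
        (dartPt (cyV β q m) (cyF β q (m + 1)) (tgtDir (cyV β q m) (cyF β q m))) := by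
      have : cyS β q (m + 1) = dartPt (cyV β q m) (cyF β q (m + 1)) (tgtDir (cyV β q m) (cyF β q m)) := by
        rw [cyS, hv, hdir]
      rw [cyConn, cyT, this] at hz
      exact hz
    refine ⟨_, J, hJI, hc, hv, hcol, hside J hJI, ?_, vConn_shape hJI hcol (hside J hJI) hz'⟩
    rw [cornerSource_eq_cornerEdge, hdir]
  · right
    have hc1 : IsCorner (cyV β q m) (cyF β q m) := isCorner_cy m
    have he' : cornerTarget (cyV β q m) (cyF β q m) = cornerSource (cyV β q (m + 1)) (cyF β q m) := he
    obtain ⟨hdir, hsum, hoth⟩ := faceTurn_dirs hv.symm he'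
    obtain ⟨J, hJI⟩ := exists_ne (tgtDir (cyV β q m) (cyF β q m))
    have hz' : z ∈ segment ℝ (dartPt (cyV β q m) (cyF β q m) (tgtDir (cyV β q m) (cyF β q m)))
        (dartPt (cyV β q (m + 1)) (cyF β q m) (tgtDir (cyV β q m) (cyF β q m))) := by
      have : cyS β q (m + 1) = dartPt (cyV β q (m + 1)) (cyF β q m) (tgtDir (cyV β q m) (cyF β q m)) := by
        rw [cyS, hf, hdir]
      rw [cyConn, cyT, this] at hz
      exact hz
    exact ⟨_, J, hJI, ho, (fConn_shape hc1 hJI hsum (hoth J hJI) hz').1⟩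

/-! ### What the pieces of the polygon can meet -/

/-- An integer is not an integer plus a proper fraction. [folklore] -/
theorem int_cast_ne_add_frac (m a : ℤ) {c : ℝ} (hc0 : 0 < c) (hc1 : c < 1) : (m : ℝ) ≠ a + c := by
  intro h
  have h1 : ((m - a : ℤ) : ℝ) = c := by push_cast; linarith
  have h2 : (0 : ℝ) < (m - a : ℤ) := by rw [h1]; exact hc0
  have h3 : ((m - a : ℤ) : ℝ) < 1 := by rw [h1]; exact hc1
  have h4 : (0 : ℤ) < m - a := by exact_mod_cast h2
  have h5 : m - a < 1 := by exact_mod_cast h3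
  omega

/-- **Lattice points miss the dart pieces.** [folklore] -/
theorem toComplex_not_mem_cyDart (u : Site 2) (m : ℕ) : Site.toComplex u ∉ cyDart β q m := by
  rw [cyDart_eq]
  intro h
  have := dartSeg_subset_openSq (isCorner_cy m) h 0
  simp only [Percolation.coordVec_toComplex] at this
  obtain ⟨h1, h2⟩ := this
  have h3 : cyF β q m 0 < u 0 := by exact_mod_cast h1
  have h4 : u 0 < cyF β q m 0 + 1 := by exact_mod_cast h2
  omega

/-- **Lattice points miss the connectors.** [folklore] -/
theorem toComplex_not_mem_cyConn (u : Site 2) (m : ℕ) : Site.toComplex u ∉ cyConn β q m := by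
  intro h
  rcases cyConn_cases m h with ⟨I, J, -, -, -, -, -, -, hshape⟩ | ⟨I, J, -, -, hshape⟩
  · obtain ⟨-, hI, -⟩ := hshape
    simp only [Percolation.coordVec_toComplex] at hI
    rcases hI with hI | hI
    · exact int_cast_ne_add_frac _ _ (by norm_num) (by norm_num) hI
    · exact int_cast_ne_add_frac _ _ (by norm_num) (by norm_num) hI
  · obtain ⟨-, -, hJ⟩ := hshape
    simp only [Percolation.coordVec_toComplex] at hJ
    rcases hJ with hJ | hJ
    · exact int_cast_ne_add_frac _ _ (by norm_num) (by norm_num) hJ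
    · exact int_cast_ne_add_frac _ _ (by norm_num) (by norm_num) hJ

/-- **Face centres miss the dart pieces.** [folklore] -/
theorem faceCenter_not_mem_cyDart (g : Site 2) (m : ℕ) : faceCenter g ∉ cyDart β q m := by
  rw [cyDart_eq]
  intro h
  have hg : g = cyF β q m := by
    funext k
    have := dartSeg_subset_openSq (isCorner_cy m) h k
    simp only [coordVec_faceCenter] at this
    obtain ⟨h1, h2⟩ := this
    have h3 : (cyF β q m k : ℝ) < g k + 1 := by linarith
    have h4 : (g k : ℝ) < cyF β q m k + 1 := by linarith
    have h5 : cyF β q m k < g k + 1 := by exact_mod_cast h3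
    have h6 : g k < cyF β q m k + 1 := by exact_mod_cast h4
    omega
  subst hg
  exact faceCenter_not_mem_dartSeg (isCorner_cy m) h

/-- **Face centres miss the connectors.** [folklore] -/
theorem faceCenter_not_mem_cyConn (g : Site 2) (m : ℕ) : faceCenter g ∉ cyConn β q m := by
  intro h
  rcases cyConn_cases m h with ⟨I, J, -, -, -, -, -, -, hshape⟩ | ⟨I, J, -, -, hshape⟩
  · obtain ⟨-, hI, -⟩ := hshape
    simp only [coordVec_faceCenter] at hI
    rcases hI with hI | hI
    · exact int_cast_ne_add_frac (g I) (cyF β q m I - 1) (c := 7 / 8) (by norm_num) (by norm_num) (by push_cast; linarith)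
    · exact int_cast_ne_add_frac (g I) (cyF β q m I) (c := 1 / 8) (by norm_num) (by norm_num) (by linarith)
  · obtain ⟨-, -, hJ⟩ := hshape
    simp only [coordVec_faceCenter] at hJ
    rcases hJ with hJ | hJ
    · exact int_cast_ne_add_frac (g J) (cyF β q m J - 1) (c := 5 / 8) (by norm_num) (by norm_num) (by push_cast; linarith)
    · exact int_cast_ne_add_frac (g J) (cyF β q m J) (c := 3 / 8) (by norm_num) (by norm_num) (by linarith)

/-- **Connectors miss half-diagonals.** [folklore] -/
theorem cyConn_disjoint_halfDiag (m : ℕ) {v f : Site 2} (hv : IsCorner v f) {z : ℂ} (hz : z ∈ cyConn β q m) :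
    z ∉ halfDiag v f := by
  rcases cyConn_cases m hz with ⟨I, J, -, -, -, -, -, -, hshape⟩ | ⟨I, J, -, -, hshape⟩
  · exact hshape.not_mem_halfDiag hv
  · exact hshape.not_mem_halfDiag hv

/-- **A dart piece meets the half-diagonal of a corner only if it is the dart of that corner.**
[folklore] -/
theorem cy_eq_of_mem_halfDiag (m : ℕ) {v : Site 2} {k : Fin 4} {z : ℂ} (hz : z ∈ cyDart β q m)
    (hz' : z ∈ halfDiag v (faceAt v k)) : cornerOrbit β q m = (v, k) := by
  rw [cyDart_eq] at hz
  obtain ⟨h1, h2⟩ := eq_of_dartSeg_inter_halfDiag (isCorner_faceAt v k) (isCorner_cy m) ⟨z, hz, hz'⟩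
  rw [cyV] at h1
  rw [cyF, cFace, h1] at h2
  refine Prod.ext h1 ?_
  have : cornerOff (cornerOrbit β q m).2 = cornerOff k := sub_right_injective h2
  have hinj : Function.Injective cornerOff := by decide
  exact hinj this

/-- **Open edges miss the connectors**: a connector meets a lattice edge only if it is the
crossed edge of a vertex turn, which is closed. [folklore] -/
theorem cyConn_disjoint_edgeTrace (hβ : β ⊆ (zdGraph 2).edgeSet) (m : ℕ) {u w : Site 2} (huw : s(u, w) ∈ β)
    {z : ℂ} (hz : z ∈ cyConn β q m) : z ∉ Percolation.edgeTrace s(u, w) := by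
  have hadj : (zdGraph 2).Adj u w := hβ huw
  intro hz'
  rcases cyConn_cases m hz with ⟨I, J, hJI, hclosed, hv, hcol, hside, hsrc, hshape⟩ | ⟨I, J, -, -, hshape⟩
  · obtain ⟨huj, hwj, hui⟩ := hshape.edge_eq hadj hz'
    rw [hcol] at hui
    have hc2 : IsCorner (cyV β q m) (cyF β q (m + 1)) := hv ▸ isCorner_cy (m + 1)
    have hedge : s(u, w) = cornerEdge (cyV β q m) (cyF β q (m + 1)) I :=
      IsMedialExploration.cornerEdge_eq_of_coords hc2 hJI huj hwj hui
    apply hclosed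
    have : cTgt (cornerOrbit β q m) = s(u, w) := by
      rw [hedge, ← hsrc, ← hv, ← cSrc_nextCorner]
      exact (cornerSource_faceAt _ _).symm
    rw [this]; exact huw
  · exact hshape.not_mem_edgeTrace hadj hz'

/-- **Open edges miss the dart pieces** (dart pieces miss every lattice edge). [folklore] -/
theorem cyDart_disjoint_edgeTrace (m : ℕ) {u w : Site 2} (hadj : (zdGraph 2).Adj u w)
    {z : ℂ} (hz : z ∈ cyDart β q m) : z ∉ Percolation.edgeTrace s(u, w) := by
  rw [cyDart_eq] at hz
  exact fun hz' => dartSeg_inter_edgeTrace (isCorner_cy m) hadj hz hz'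

/-! ### Winding numbers of the closed polygon -/

/-- `ℓ` off the polygon if it is off all pieces. [folklore] -/
theorem not_mem_range_cyLoop {n : ℕ} (h : cornerOrbit β q (n + 1) = q) {z : ℂ}
    (hd : ∀ j ≤ n, z ∉ cyDart β q j) (hc : ∀ j ≤ n, z ∉ cyConn β q j) : z ∉ range (cyLoop n h) := by
  intro hz
  rcases range_cyLoop_subset n h hz with h' | h'
  · obtain ⟨j, hj, h'⟩ := mem_iUnion₂.1 h'; exact hd j hj h'
  · obtain ⟨j, hj, h'⟩ := mem_iUnion₂.1 h'; exact hc j hj h'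

/-- **Points joined by a segment off the polygon have the same winding number.** [folklore] -/
theorem wind_cyLoop_eq_of_segment {n : ℕ} (h : cornerOrbit β q (n + 1) = q) {a b : ℂ}
    (hab : ∀ z ∈ segment ℝ a b, z ∉ range (cyLoop n h)) :
    wind (fun t => (cyLoop n h).extend t - a) = wind (fun t => (cyLoop n h).extend t - b) := by
  set γ := cyLoop (β := β) (q := q) n h
  have hK : IsClosed (range γ) := (isCompact_range γ.continuous).isClosed
  refine Topology.PlaneTopology.wind_sub_eq_of_mem_connectedComponentIn (Γ := γ.extend) γ.continuous_extend.continuousOn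
    (by rw [γ.extend_zero, γ.extend_one]) hK (fun t ht => ?_) ?_
  · rw [γ.extend_apply ht]; exact mem_range_self _
  · have hsub : segment ℝ a b ⊆ (range γ)ᶜ := fun z hz hz' => hab z hz hz'
    exact (convex_segment a b).isPreconnected.subset_connectedComponentIn (left_mem_segment _ _ _) hsub
      (right_mem_segment _ _ _)

/-- **Endpoints of an open edge have the same winding number** (open edges miss the polygon).
[folklore] -/
theorem wind_cyLoop_eq_of_mem (hβ : β ⊆ (zdGraph 2).edgeSet) {n : ℕ} (h : cornerOrbit β q (n + 1) = q)
    {u w : Site 2} (huw : s(u, w) ∈ β) :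
    wind (fun t => (cyLoop n h).extend t - Site.toComplex u) = wind (fun t => (cyLoop n h).extend t - Site.toComplex w) := by
  refine wind_cyLoop_eq_of_segment h fun z hz => not_mem_range_cyLoop h (fun j _ hzj => ?_) (fun j _ hzj => ?_)
  · exact cyDart_disjoint_edgeTrace j (hβ huw) hzj (by rw [Percolation.edgeTrace_mk]; exact hz)
  · exact cyConn_disjoint_edgeTrace hβ j huw hzj (by rw [Percolation.edgeTrace_mk]; exact hz)

/-- Along a walk of open edges the winding number is constant. [folklore] -/
theorem wind_cyLoop_eq_of_reachable (hβ : β ⊆ (zdGraph 2).edgeSet) {n : ℕ} (h : cornerOrbit β q (n + 1) = q)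
    {u w : Site 2} (huw : (Percolation.openGraph β).Reachable u w) :
    wind (fun t => (cyLoop n h).extend t - Site.toComplex u) = wind (fun t => (cyLoop n h).extend t - Site.toComplex w) := by
  obtain ⟨p⟩ := huw
  induction p with
  | nil => rfl
  | cons hadj _ ih =>
    rw [Percolation.openGraph_adj] at hadj
    exact (wind_cyLoop_eq_of_mem hβ h hadj.1).trans ih

end Cycle

/-! ### The separation fact -/

/-- **T1, proved: a cycle of the turning rule through one of the two corners arriving at a
closed edge, missing the other, separates the endpoints of the edge.** The closed perturbed
polygon of the cycle crosses the half-diagonal from the far endpoint `y` into the common face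
exactly once (by its first dart piece, transversally: winding numbers of `y` and of the face
centre differ), misses the half-diagonal from the near endpoint `x` (its only possible dart
would be the successor of the missing corner), and misses every open edge; so `x` and `y` have
different winding numbers and are not joined by open edges. [folklore] -/
theorem medialCycle_separates_holds : medialCycle_separates := by
  intro β hβ p he Q hQ0 hQ hL hreach
  classical
  -- the minimal period of the cycle through the partner
  have hex : ∃ n, 0 < n ∧ cornerOrbit β (cornerPartner p) n = cornerPartner p := ⟨Q, hQ0, hQ⟩
  obtain ⟨hP0, hP⟩ := Nat.find_spec hex
  have hPmin : ∀ s, 0 < s → s < Nat.find hex → cornerOrbit β (cornerPartner p) s ≠ cornerPartner p :=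
    fun s hs hsP h => Nat.find_min hex hsP ⟨hs, h⟩
  obtain ⟨n, hn⟩ : ∃ n, Nat.find hex = n + 1 := ⟨Nat.find hex - 1, by omega⟩
  rw [hn] at hP hPmin
  set q := cornerPartner p with hq
  -- the common face `f` of the two arriving corners, seen from `y` and from `x`
  have hyq : q.1 = p.1 + cornerUnit (p.2 + 1) := rfl
  have hfq : cFace q = faceAt q.1 q.2 := rfl
  have hfx : cFace q = faceAt p.1 (p.2 + 1) := by
    rw [hfq, hyq, show q.2 = (p.2 + 1) + 1 by rw [hq, cornerPartner]; simp only; omega, faceAt_add_unit_succ]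
  set γ := cyLoop (β := β) (q := q) n hP with hγ
  set ℓ := Site.toComplex q.1 with hℓ
  set r := faceCenter (cFace q) with hr
  -- (A) one transversal crossing of `[y, centre]`: by the first dart piece only
  have hhalf : halfDiag q.1 (faceAt q.1 q.2) = segment ℝ ℓ r := rfl
  have hd : ∀ j, 1 ≤ j → j ≤ n → ∀ z ∈ cyDart β q j, z ∉ segment ℝ ℓ r := by
    intro j hj1 hjn z hz hz'
    rw [← hhalf] at hz'
    have := cy_eq_of_mem_halfDiag j hz hz'
    exact hPmin j hj1 (by omega) (this.trans (Prod.ext rfl rfl))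
  have hc : ∀ j ≤ n, ∀ z ∈ cyConn β q j, z ∉ segment ℝ ℓ r := by
    intro j _ z hz hz'
    rw [← hhalf] at hz'
    exact cyConn_disjoint_halfDiag j (isCorner_faceAt q.1 q.2) hz hz'
  have hℓγ : ℓ ∉ range γ := not_mem_range_cyLoop hP (fun j _ => toComplex_not_mem_cyDart _ _)
    (fun j _ => toComplex_not_mem_cyConn _ _)
  have hrγ : r ∉ range γ := not_mem_range_cyLoop hP (fun j _ => faceCenter_not_mem_cyDart _ _)
    (fun j _ => faceCenter_not_mem_cyConn _ _)
  have hcross : γ.crossInc ℓ r ≠ 0 := by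
    rw [hγ, crossInc_cyLoop_eq n hP hd hc (toComplex_not_mem_cyDart _ _) (faceCenter_not_mem_cyDart _ _)]
    -- the first dart piece is `dartSeg y f`, read in one of its two orientations
    have key := crossInc_dartSeg_ne_zero (isCorner_faceAt q.1 q.2)
    have h01 : ∀ v f : Site 2, (srcDir v f = 0 ∧ tgtDir v f = 1) ∨ (srcDir v f = 1 ∧ tgtDir v f = 0) := by
      intro v f; unfold srcDir tgtDir; split_ifs <;> simp
    rcases h01 (cyV β q 0) (cyF β q 0) with ⟨h0, h1⟩ | ⟨h0, h1⟩
    · rw [cyS, cyT, h0, h1]; exact key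
    · rw [cyS, cyT, h0, h1, ← Path.segment_symm, Path.crossInc_symm]
      · exact neg_ne_zero.2 key
      · rw [Path.range_segment]; exact fun h' => toComplex_not_mem_dartSeg (isCorner_faceAt q.1 q.2) h'
      · rw [Path.range_segment]; exact fun h' => faceCenter_not_mem_dartSeg (isCorner_faceAt q.1 q.2) h'
  have hA : wind (fun t => γ.extend t - ℓ) ≠ wind (fun t => γ.extend t - r) := by
    intro hw
    rw [Path.crossInc_loop γ hℓγ hrγ, hw, sub_self, zero_mul] at hcross
    exact hcross rfl
  -- (B) no crossing of `[x, centre]`: the only candidate dart is the successor of `p`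
  have hsucc : nextCorner β p = (p.1, p.2 + 1) := nextCorner_of_not_mem he
  have hB : wind (fun t => γ.extend t - Site.toComplex p.1) = wind (fun t => γ.extend t - r) := by
    refine wind_cyLoop_eq_of_segment hP fun z hz => not_mem_range_cyLoop hP (fun j hj hzj => ?_) (fun j hj hzj => ?_)
    · have hz' : z ∈ halfDiag p.1 (faceAt p.1 (p.2 + 1)) := by rw [halfDiag, ← hfx]; exact hz
      have hj := cy_eq_of_mem_halfDiag j hzj hz'
      -- then the predecessor of that dart on the cycle is `p`
      have hper : cornerOrbit β q (j + n + 1) = cornerOrbit β q j := by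
        rw [add_assoc]; exact cornerOrbit_add_period hP j
      have : nextCorner β (cornerOrbit β q (j + n)) = nextCorner β p := by
        rw [hsucc, ← hj, ← hper]; rfl
      exact hL (j + n) (nextCorner_injective this)
    · have hz' : z ∈ halfDiag p.1 (faceAt p.1 (p.2 + 1)) := by rw [halfDiag, ← hfx]; exact hz
      exact cyConn_disjoint_halfDiag j (isCorner_faceAt p.1 (p.2 + 1)) hzj hz'
  -- (C) open edges do not change the winding number
  have hC := wind_cyLoop_eq_of_reachable hβ hP hreach
  exact hA (hC.symm.trans hB)

/-- **Node 1 of crit-ising.S18 modulo the Umlaufsatz alone**: with T1 proved, the corrected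
s-holomorphicity fact follows from `medialCycle_turning` (T2). [cite: Smirnov2010, Lemma 4.5] -/
theorem isSHolomorphic_fkIsingObservable_of_zdArcA_connected_of_turning (hT2 : medialCycle_turning) :
    isSHolomorphic_fkIsingObservable_of_zdArcA_connected :=
  isSHolomorphic_fkIsingObservable_of_zdArcA_connected_of_planar medialCycle_separates_holds hT2

end Literature.Probability.LatticeModels
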